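import Literature.Combinatorics.StablePolynomials.JensenMultipliersMultivariate
import Literature.Combinatorics.StablePolynomials.SzaszInequality
import Literature.Combinatorics.StablePolynomials.GraceWalshSzego
import Mathlib.Data.Finsupp.Multiset
import HarnessLib

/-!
# The multivariate Szász coefficient bound (Borcea–Brändén I, Lemma 5.4)

J. Borcea, P. Brändén, *The Lee–Yang and Pólya–Schur programs. I. Linear operators preserving stability*,
Invent. Math. 177 (2009) 541–569 (arXiv:0809.0401), §5.2:

> **Lemma 5.4.** Suppose that the polynomial `f(z) = 1 + Σ_{|β|>0} a(β) z^β ∈ ℂ[z_1,…,z_n]` is stable and let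
> `A = [3(Σ_{i=1}^n |a(e_i)|)^2 + 2 Σ_{i,j=1}^n |a(e_i+e_j)|]^{1/2}`. Then
> `|a(β)| ≤ |β|^{-|β|/2} (β^β/β!) A^{|β|}`, `β ∈ ℕⁿ`, where `|β| = Σ_i β_i`.
>
> *Proof.* … suppose that `β ≠ 0` is such that `a(β) ≠ 0`. Since the operator `z^α ↦ J(α,β) z^α` preserves
> stability (Lemma 5.2) the polynomial `J(β,β) a(β) z^β + Σ_{0<|α|<|β|} J(α,β) a(α) z^α + 1` is stable. Setting
> all variables equal to `t` we deduce that the univariate polynomial `g(t)` of degree `k = |β|` given by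
> `g(t) = (β!/β^β) a(β) t^k + Σ_{2<|α|<k} J(α,β) a(α) t^{|α|} + [Σ_{i≠j} a(e_i+e_j) + Σ_i (1-1/β_i) a(2e_i)] t^2
> + Σ_{i : β_i ≥ 1} a(e_i) t + 1` is stable. If we rewrite `g(t) = Σ a_i t^i = Π_j (1 + ξ_j t)` then by Lemma 5.3
> we get `|β!/β^β a(β)| = Π_j |ξ_j| ≤ [Σ_j |ξ_j|^2 / k]^{k/2} ≤ (3|a_1|^2 + 2|a_2|)^{k/2} k^{-k/2} ≤ A^k k^{-k/2}`,
> which is the desired estimate. □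

This file follows the printed proof with the tree's ingredients: `jensenOp_stable_or_zero` (Lemma 5.2,
`JensenMultipliersMultivariate.lean`), the projection `Π↓ = diagonal` (`GraceWalshSzego.lean`) and the univariate
bound `norm_leadingCoeff_sq_le_of_stable` (Lemma 5.3 with the AM–GM step, `SzaszInequality.lean`). The
coefficients of `g = Π↓(J_β f)` are `g_m = Σ_{|α|=m} J(α,β) a(α)` (`coeff_diagonal_mvMultiplierOp`); since
`0 ≤ J(α,β) ≤ 1` (`norm_jensenJ_le_one`), `|g_1| ≤ Σ_i |a(e_i)|` and `|g_2| ≤ Σ_{i,j} |a(e_i+e_j)|`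
(`norm_coeff_one_le`, `norm_coeff_two_le`), which is all the printed estimate `3|a_1|^2 + 2|a_2| ≤ A^2` uses. The
conclusion is written with natural powers: `|a(β)| ≤ (β^β/β!) · (√(A^2/|β|))^{|β|}`, which equals the printed
`|β|^{-|β|/2} (β^β/β!) A^{|β|}`.

## Contents

* §1 `coeff_mvMultiplierOp`, `diagonal_monomial`, `coeff_diagonal_mvMultiplierOp`.
* §2 `norm_jensenJ_le_one`, `jensenJ_self_ne_zero`, `norm_jensenJ_self`.
* §3 multi-indices of weight `0, 1, 2`: `eq_zero_of_sum_eq_zero`, `eq_single_of_sum_eq_one`,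
  `eq_single_add_single_of_sum_eq_two`; `norm_coeff_one_le`, `norm_coeff_two_le`.
* §4 `szaszA f = A^2` and **`BorceaBranden_lemma_5_4_sq`**, **`BorceaBranden_lemma_5_4`**.

## References

* [BorceaBranden2009] J. Borcea, P. Brändén, Invent. Math. 177 (2009) 541–569, §5.2 Lemma 5.4 and its proof.
-/

noncomputable section

open MvPolynomial Finset

namespace Literature.Combinatorics.StablePolynomials

variable {τ : Type*}

/-! ## §1 Coefficients of diagonal operators and of their projections `Π↓` -/

section Coeff

/-- **Coefficients of `z^α ↦ b(α) z^α`**: `[z^s] (Λ_b p) = b(s) [z^s] p`. [cite: BorceaBranden2009, §5.1 Lemma 5.2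
(the diagonal operators)] -/
theorem coeff_mvMultiplierOp {R : Type*} [CommSemiring R] (b : (τ →₀ ℕ) → R) (p : MvPolynomial τ R)
    (s : τ →₀ ℕ) : coeff s (mvMultiplierOp b p) = b s * coeff s p := by
  classical
  induction p using MvPolynomial.induction_on' with
  | monomial t a =>
    rw [mvMultiplierOp_monomial, coeff_monomial, coeff_monomial]
    split_ifs with h
    · rw [h]
    · rw [mul_zero]
  | add p q hp hq => rw [map_add, coeff_add, coeff_add, hp, hq, mul_add]

variable [Fintype τ]

/-- **`Π↓(c z^s) = c t^{|s|}`.** [cite: BorceaBranden2009, §5.2 proof of Lemma 5.4 ("Setting all variables equal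
to `t`")] -/
theorem diagonal_monomial {R : Type*} [CommSemiring R] (s : τ →₀ ℕ) (c : R) :
    diagonal (monomial s c) = Polynomial.C c * Polynomial.X ^ (∑ i, s i) := by
  rw [diagonal, aeval_monomial, Polynomial.algebraMap_eq, Finsupp.prod_fintype _ _ fun i => pow_zero _,
    prod_pow_eq_pow_sum]

/-- **`Π↓(Λ_b F) = Σ_s b(s) [z^s]F · t^{|s|}`.** [cite: BorceaBranden2009, §5.2 proof of Lemma 5.4] -/
theorem diagonal_mvMultiplierOp_eq_sum (b : (τ →₀ ℕ) → ℂ) (F : MvPolynomial τ ℂ) :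
    diagonal (mvMultiplierOp b F) =
      ∑ s ∈ F.support, Polynomial.C (b s * coeff s F) * Polynomial.X ^ (∑ i, s i) := by
  conv_lhs => rw [F.as_sum, map_sum, map_sum]
  exact sum_congr rfl fun s _ => by rw [mvMultiplierOp_monomial, diagonal_monomial]

/-- **The coefficients of `g(t) = (Λ_b F)(t,…,t)`**: `g_m = Σ_{|s| = m} b(s) [z^s]F`.
[cite: BorceaBranden2009, §5.2 proof of Lemma 5.4 (the displayed coefficients of `g`)] -/
theorem coeff_diagonal_mvMultiplierOp (b : (τ →₀ ℕ) → ℂ) (F : MvPolynomial τ ℂ) (m : ℕ) :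
    (diagonal (mvMultiplierOp b F)).coeff m = ∑ s ∈ F.support with (∑ i, s i) = m, b s * coeff s F := by
  rw [diagonal_mvMultiplierOp_eq_sum, Polynomial.finsetSum_coeff, sum_filter]
  refine sum_congr rfl fun s _ => ?_
  rw [Polynomial.coeff_C_mul_X_pow]
  by_cases h : (∑ i, s i) = m
  · rw [if_pos h.symm, if_pos h]
  · rw [if_neg (Ne.symm h), if_neg h]

end Coeff

/-! ## §2 Size of the Jensen multipliers -/

section JensenSize

variable [Fintype τ]

/-- **`0 ≤ J(α,β) ≤ 1`**: each factor `(β_i)_{α_i}/β_i^{α_i}` lies in `[0,1]` (`(m)_k ≤ m^k`).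
[cite: BorceaBranden2009, §5.1 (definition of `J(α,β)`)] -/
theorem norm_jensenJ_le_one (α β : τ → ℕ) : ‖jensenJ ℂ α β‖ ≤ 1 := by
  rw [jensenJ, norm_prod]
  refine prod_le_one (fun i _ => norm_nonneg _) fun i _ => ?_
  rw [norm_div, norm_pow, Complex.norm_natCast, Complex.norm_natCast]
  exact div_le_one_of_le₀ (by exact_mod_cast Nat.descFactorial_le_pow (β i) (α i)) (pow_nonneg (Nat.cast_nonneg _) _)

/-- **`J(β,β) = β!/β^β ≠ 0`.** [cite: BorceaBranden2009, §5.2 proof of Lemma 5.4 ("`g(t) = (β!/β^β) a(β) t^k +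
…` of degree `k`")] -/
theorem jensenJ_self_ne_zero (β : τ → ℕ) : jensenJ ℂ β β ≠ 0 := by
  rw [jensenJ]
  refine prod_ne_zero_iff.2 fun i _ => div_ne_zero ?_ ?_
  · rw [Nat.descFactorial_self, Nat.cast_ne_zero]
    exact Nat.factorial_ne_zero _
  · rcases Nat.eq_zero_or_pos (β i) with h | h
    · rw [h, pow_zero]
      exact one_ne_zero
    · exact pow_ne_zero _ (Nat.cast_ne_zero.2 h.ne')

/-- **`|J(β,β)| = β!/β^β = Π_i β_i!/β_i^{β_i}`.** [cite: BorceaBranden2009, §5.2 proof of Lemma 5.4] -/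
theorem norm_jensenJ_self (β : τ → ℕ) :
    ‖jensenJ ℂ β β‖ = (∏ i, ((β i).factorial : ℝ)) / ∏ i, (β i : ℝ) ^ β i := by
  rw [jensenJ, norm_prod, ← prod_div_distrib]
  refine prod_congr rfl fun i _ => ?_
  rw [norm_div, norm_pow, Complex.norm_natCast, Complex.norm_natCast, Nat.descFactorial_self]

end JensenSize

/-! ## §3 Multi-indices of weight `0`, `1`, `2` and the coefficients `g_0, g_1, g_2` -/

section LowDegree

variable [Fintype τ]

/-- The multiset of a multi-index has `|s|` elements. [folklore] -/
private theorem card_toMultiset_eq (s : τ →₀ ℕ) : (Finsupp.toMultiset s).card = ∑ i, s i := by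
  rw [Finsupp.card_toMultiset]
  exact Finsupp.sum_fintype _ _ fun _ => rfl

/-- `|s| = 0` forces `s = 0`. [cite: BorceaBranden2009, §5.2 proof of Lemma 5.4 (the constant term `1` of
`g`)] -/
theorem eq_zero_of_sum_eq_zero (s : τ →₀ ℕ) (h : ∑ i, s i = 0) : s = 0 :=
  Finsupp.ext fun i => (sum_eq_zero_iff.1 h) i (mem_univ i)

/-- `|s| = 1` forces `s = e_i`. [cite: BorceaBranden2009, §5.2 proof of Lemma 5.4 (the coefficient of `t`)] -/
theorem eq_single_of_sum_eq_one [DecidableEq τ] (s : τ →₀ ℕ) (h : ∑ i, s i = 1) :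
    ∃ i, s = Finsupp.single i 1 := by
  have hc : (Finsupp.toMultiset s).card = 1 := by rw [card_toMultiset_eq, h]
  obtain ⟨i, hi⟩ := Multiset.card_eq_one.1 hc
  refine ⟨i, ?_⟩
  have h2 : Finsupp.toMultiset s = Finsupp.toMultiset (Finsupp.single i 1) := by
    rw [hi, Finsupp.toMultiset_single, one_nsmul]
  have h3 := congrArg Multiset.toFinsupp h2
  rwa [Finsupp.toMultiset_toFinsupp, Finsupp.toMultiset_toFinsupp] at h3

/-- `|s| = 2` forces `s = e_i + e_j`. [cite: BorceaBranden2009, §5.2 proof of Lemma 5.4 (the coefficient of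
`t^2`)] -/
theorem eq_single_add_single_of_sum_eq_two [DecidableEq τ] (s : τ →₀ ℕ) (h : ∑ i, s i = 2) :
    ∃ i j, s = Finsupp.single i 1 + Finsupp.single j 1 := by
  have hc : (Finsupp.toMultiset s).card = 2 := by rw [card_toMultiset_eq, h]
  obtain ⟨i, j, hij⟩ := Multiset.card_eq_two.1 hc
  refine ⟨i, j, ?_⟩
  have h2 : Finsupp.toMultiset s = Finsupp.toMultiset (Finsupp.single i 1 + Finsupp.single j 1) := by
    rw [hij, Finsupp.toMultiset_add, Finsupp.toMultiset_single, Finsupp.toMultiset_single, one_nsmul, one_nsmul,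
      Multiset.insert_eq_cons, Multiset.singleton_add]
  have h3 := congrArg Multiset.toFinsupp h2
  rwa [Finsupp.toMultiset_toFinsupp, Finsupp.toMultiset_toFinsupp] at h3

/-- **`|g_m| ≤ Σ_{|s|=m} |a(s)|`** for `g = Π↓(J_β f)` (since `|J(α,β)| ≤ 1`). [cite: BorceaBranden2009, §5.2 proof
of Lemma 5.4] -/
theorem norm_coeff_diagonal_jensenOp_le (β : τ → ℕ) (f : MvPolynomial τ ℂ) (m : ℕ) :
    ‖(diagonal (jensenOp ℂ β f)).coeff m‖ ≤ ∑ s ∈ f.support with (∑ i, s i) = m, ‖coeff s f‖ := by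
  rw [jensenOp, coeff_diagonal_mvMultiplierOp]
  refine (norm_sum_le _ _).trans (sum_le_sum fun s _ => ?_)
  rw [norm_mul]
  exact (mul_le_mul_of_nonneg_right (norm_jensenJ_le_one _ _) (norm_nonneg _)).trans (by rw [one_mul])

/-- **`|g_1| ≤ Σ_i |a(e_i)|`** ("`Σ_{i : β_i ≥ 1} a(e_i) t`"). [cite: BorceaBranden2009, §5.2 proof of Lemma 5.4] -/
theorem norm_coeff_one_le [DecidableEq τ] (β : τ → ℕ) (f : MvPolynomial τ ℂ) :
    ‖(diagonal (jensenOp ℂ β f)).coeff 1‖ ≤ ∑ i, ‖coeff (Finsupp.single i 1) f‖ := by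
  refine (norm_coeff_diagonal_jensenOp_le β f 1).trans ?_
  have hsub : (f.support.filter fun s => ∑ i, s i = 1) ⊆ (univ : Finset τ).image fun i => Finsupp.single i 1 := by
    intro s hs
    obtain ⟨i, hi⟩ := eq_single_of_sum_eq_one s (mem_filter.1 hs).2
    exact mem_image.2 ⟨i, mem_univ _, hi.symm⟩
  refine (sum_le_sum_of_subset_of_nonneg hsub fun _ _ _ => norm_nonneg _).trans ?_
  exact sum_image_le_of_nonneg fun _ _ => norm_nonneg _

/-- **`|g_2| ≤ Σ_{i,j} |a(e_i+e_j)|`** ("`[Σ_{i≠j} a(e_i+e_j) + Σ_i (1-1/β_i) a(2e_i)] t^2`").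
[cite: BorceaBranden2009, §5.2 proof of Lemma 5.4] -/
theorem norm_coeff_two_le [DecidableEq τ] (β : τ → ℕ) (f : MvPolynomial τ ℂ) :
    ‖(diagonal (jensenOp ℂ β f)).coeff 2‖ ≤ ∑ i, ∑ j, ‖coeff (Finsupp.single i 1 + Finsupp.single j 1) f‖ := by
  refine (norm_coeff_diagonal_jensenOp_le β f 2).trans ?_
  have hsub : (f.support.filter fun s => ∑ i, s i = 2) ⊆
      (univ : Finset (τ × τ)).image fun p => Finsupp.single p.1 1 + Finsupp.single p.2 1 := by
    intro s hs
    obtain ⟨i, j, hij⟩ := eq_single_add_single_of_sum_eq_two s (mem_filter.1 hs).2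
    exact mem_image.2 ⟨(i, j), mem_univ _, hij.symm⟩
  refine (sum_le_sum_of_subset_of_nonneg hsub fun _ _ _ => norm_nonneg _).trans ?_
  refine (sum_image_le_of_nonneg fun _ _ => norm_nonneg _).trans ?_
  exact le_of_eq (Fintype.sum_prod_type _)

end LowDegree

/-! ## §4 Lemma 5.4 -/

section Main

variable [Fintype τ]

/-- **`A^2 = 3(Σ_i |a(e_i)|)^2 + 2 Σ_{i,j} |a(e_i+e_j)|`** for `f = Σ a(β) z^β`. [cite: BorceaBranden2009, §5.2
Lemma 5.4 (the constant `A`)] -/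
def szaszA (f : MvPolynomial τ ℂ) : ℝ :=
  3 * (∑ i, ‖coeff (Finsupp.single i 1) f‖) ^ 2 + 2 * ∑ i, ∑ j, ‖coeff (Finsupp.single i 1 + Finsupp.single j 1) f‖

/-- `A^2 ≥ 0`. [cite: BorceaBranden2009, §5.2 Lemma 5.4] -/
theorem szaszA_nonneg (f : MvPolynomial τ ℂ) : 0 ≤ szaszA f := by
  unfold szaszA
  positivity

/-- **`J(0,β) = 1`**: the constant term of `J_β f` is that of `f`. [cite: BorceaBranden2009, §5.2 proof of Lemma
5.4 ("`… + 1` is stable")] -/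
theorem jensenJ_zero_left (β : τ → ℕ) : jensenJ ℂ (⇑(0 : τ →₀ ℕ)) β = 1 := by
  rw [jensenJ]
  exact prod_eq_one fun i _ => by
    rw [Finsupp.coe_zero, Pi.zero_apply, Nat.descFactorial_zero, pow_zero, Nat.cast_one, div_one]

variable [DecidableEq τ]

/-- **Borcea–Brändén I, Lemma 5.4 (squared form).** If `f = 1 + Σ_{|β|>0} a(β) z^β ∈ ℂ[z_τ]` is stable then for
every `β` with `|β| = k`: `(β!/β^β)^2 |a(β)|^2 ≤ (A^2/k)^k`. [cite: BorceaBranden2009, §5.2 Lemma 5.4 and its proof] -/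
theorem BorceaBranden_lemma_5_4_sq {f : MvPolynomial τ ℂ} (hf : IsUpperHalfPlaneStable f) (h0 : coeff 0 f = 1)
    (β : τ → ℕ) :
    (‖jensenJ ℂ β β‖ * ‖coeff (toF β) f‖) ^ 2 ≤ (szaszA f / (∑ i, β i : ℕ)) ^ (∑ i, β i) := by
  by_cases haβ : coeff (toF β) f = 0
  · rw [haβ, norm_zero, mul_zero, zero_pow two_ne_zero]
    exact pow_nonneg (div_nonneg (szaszA_nonneg f) (Nat.cast_nonneg _)) _
  -- `F = J_β f` is stable (Lemma 5.2; not `0` since its constant term is `1`)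
  have hF0 : coeff 0 (jensenOp ℂ β f) = 1 := by
    rw [jensenOp, coeff_mvMultiplierOp, jensenJ_zero_left, one_mul, h0]
  have hF : IsUpperHalfPlaneStable (jensenOp ℂ β f) := by
    rcases jensenOp_stable_or_zero β hf with h | h
    · exact h
    · exfalso
      rw [h, coeff_zero] at hF0
      exact zero_ne_one hF0
  -- `g(t) = F(t,…,t)` is stable with `g(0) = 1`
  have hgs : ∀ t : ℂ, 0 < t.im → (diagonal (jensenOp ℂ β f)).eval t ≠ 0 := fun t ht => by
    rw [eval_diagonal]
    exact hF _ fun _ => ht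
  have hg0 : (diagonal (jensenOp ℂ β f)).coeff 0 = 1 := by
    rw [jensenOp, coeff_diagonal_mvMultiplierOp, sum_eq_single_of_mem (0 : τ →₀ ℕ)]
    · rw [jensenJ_zero_left, one_mul, h0]
    · refine mem_filter.2 ⟨mem_support_iff.2 (by rw [h0]; exact one_ne_zero), ?_⟩
      simp only [Finsupp.coe_zero, Pi.zero_apply, sum_const_zero]
    · intro s hs hs0
      exact absurd (eq_zero_of_sum_eq_zero s (mem_filter.1 hs).2) hs0
  -- `J(α,β) ≠ 0` forces `α ≤ β`
  have hJ0 : ∀ s : τ →₀ ℕ, jensenJ ℂ (⇑s) β ≠ 0 → ⇑s ≤ β := fun s hs => by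
    by_contra h
    exact hs (jensenJ_eq_zero ℂ h)
  -- the top coefficient: only `α = β` has `|α| = k = |β|` and `J(α,β) ≠ 0`
  have hgk : (diagonal (jensenOp ℂ β f)).coeff (∑ i, β i) = jensenJ ℂ β β * coeff (toF β) f := by
    rw [jensenOp, coeff_diagonal_mvMultiplierOp]
    have hmem : toF β ∈ f.support.filter fun s => ∑ i, s i = ∑ i, β i :=
      mem_filter.2 ⟨mem_support_iff.2 haβ, sum_congr rfl fun i _ => rfl⟩
    rw [sum_eq_single_of_mem (toF β) hmem]
    · rfl
    · intro s hs hne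
      by_cases hJ : jensenJ ℂ (⇑s) β = 0
      · rw [hJ, zero_mul]
      · exfalso
        have hle : ⇑s ≤ β := hJ0 s hJ
        have heq : ∀ i ∈ (univ : Finset τ), s i = β i :=
          (sum_eq_sum_iff_of_le fun i _ => hle i).1 (mem_filter.1 hs).2
        exact hne (Finsupp.ext fun i => (heq i (mem_univ i)).trans (toF_apply β i).symm)
  -- no coefficients above `k`
  have hdeg_le : (diagonal (jensenOp ℂ β f)).natDegree ≤ ∑ i, β i := by
    rw [Polynomial.natDegree_le_iff_coeff_eq_zero]
    intro N hN
    rw [jensenOp, coeff_diagonal_mvMultiplierOp]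
    refine sum_eq_zero fun s hs => ?_
    by_cases hJ : jensenJ ℂ (⇑s) β = 0
    · rw [hJ, zero_mul]
    · exfalso
      have hle : ⇑s ≤ β := hJ0 s hJ
      have h1 : ∑ i, s i ≤ ∑ i, β i := sum_le_sum fun i _ => hle i
      rw [(mem_filter.1 hs).2] at h1
      exact absurd hN (not_lt.2 h1)
  have hgk0 : (diagonal (jensenOp ℂ β f)).coeff (∑ i, β i) ≠ 0 := by
    rw [hgk]
    exact mul_ne_zero (jensenJ_self_ne_zero β) haβ
  have hdeg : (diagonal (jensenOp ℂ β f)).natDegree = ∑ i, β i :=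
    Polynomial.natDegree_eq_of_le_of_coeff_ne_zero hdeg_le hgk0
  have hlead : (diagonal (jensenOp ℂ β f)).leadingCoeff = jensenJ ℂ β β * coeff (toF β) f := by
    rw [Polynomial.leadingCoeff, hdeg, hgk]
  -- Lemma 5.3 + AM–GM for `g`
  have hbound := norm_leadingCoeff_sq_le_of_stable hg0 hgs
  rw [hlead, hdeg, norm_mul] at hbound
  refine hbound.trans ?_
  -- `3|g_1|² + 2|g_2| ≤ A²`
  have h1 := norm_coeff_one_le β f
  have h2 := norm_coeff_two_le β f
  have hA : 3 * ‖(diagonal (jensenOp ℂ β f)).coeff 1‖ ^ 2 + 2 * ‖(diagonal (jensenOp ℂ β f)).coeff 2‖ ≤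
      szaszA f := by
    unfold szaszA
    have h1' := pow_le_pow_left₀ (norm_nonneg _) h1 2
    nlinarith [h1', h2]
  exact pow_le_pow_left₀ (div_nonneg (by positivity) (Nat.cast_nonneg _))
    (div_le_div_of_nonneg_right hA (Nat.cast_nonneg _)) _

/-- **Borcea–Brändén I, Lemma 5.4.** If `f(z) = 1 + Σ_{|β|>0} a(β) z^β ∈ ℂ[z_1,…,z_n]` is stable and
`A^2 = 3(Σ_i |a(e_i)|)^2 + 2 Σ_{i,j} |a(e_i+e_j)|`, then for every `β ∈ ℕⁿ`
`|a(β)| ≤ (β^β/β!) (√(A^2/|β|))^{|β|} = |β|^{-|β|/2} (β^β/β!) A^{|β|}` (`β^β = Π β_i^{β_i}`, `β! = Π β_i!`,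
`0^0 = 1`). [cite: BorceaBranden2009, §5.2 Lemma 5.4] -/
theorem BorceaBranden_lemma_5_4 {f : MvPolynomial τ ℂ} (hf : IsUpperHalfPlaneStable f) (h0 : coeff 0 f = 1)
    (β : τ → ℕ) :
    ‖coeff (toF β) f‖ ≤
      ((∏ i, (β i : ℝ) ^ β i) / ∏ i, ((β i).factorial : ℝ)) *
        Real.sqrt (szaszA f / (∑ i, β i : ℕ)) ^ (∑ i, β i) := by
  have h := BorceaBranden_lemma_5_4_sq hf h0 β
  have hB : 0 ≤ szaszA f / (∑ i, β i : ℕ) := div_nonneg (szaszA_nonneg f) (Nat.cast_nonneg _)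
  -- unsquare
  have h2 : (szaszA f / (∑ i, β i : ℕ)) ^ (∑ i, β i) = (Real.sqrt (szaszA f / (∑ i, β i : ℕ)) ^ (∑ i, β i)) ^ 2 := by
    rw [← pow_mul, pow_mul', Real.sq_sqrt hB]
  rw [h2] at h
  have h3 := Real.sqrt_le_sqrt h
  rw [Real.sqrt_sq (mul_nonneg (norm_nonneg _) (norm_nonneg _)),
    Real.sqrt_sq (pow_nonneg (Real.sqrt_nonneg _) _), norm_jensenJ_self] at h3
  -- divide by `β!/β^β > 0`
  have hfac : 0 < ∏ i, ((β i).factorial : ℝ) := prod_pos fun i _ => Nat.cast_pos.2 (Nat.factorial_pos _)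
  have hpow : 0 < ∏ i, (β i : ℝ) ^ β i := prod_pos fun i _ => by
    rcases Nat.eq_zero_or_pos (β i) with h | h
    · rw [h, pow_zero]
      exact one_pos
    · exact pow_pos (Nat.cast_pos.2 h) _
  rw [div_mul_eq_mul_div, le_div_iff₀ hfac]
  calc ‖coeff (toF β) f‖ * ∏ i, ((β i).factorial : ℝ)
      = ((∏ i, ((β i).factorial : ℝ)) / (∏ i, (β i : ℝ) ^ β i) * ‖coeff (toF β) f‖) *
          ∏ i, (β i : ℝ) ^ β i := by
        rw [div_mul_eq_mul_div, div_mul_cancel₀ _ hpow.ne']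
        ring
    _ ≤ Real.sqrt (szaszA f / (∑ i, β i : ℕ)) ^ (∑ i, β i) * ∏ i, (β i : ℝ) ^ β i :=
        mul_le_mul_of_nonneg_right h3 hpow.le
    _ = (∏ i, (β i : ℝ) ^ β i) * Real.sqrt (szaszA f / (∑ i, β i : ℕ)) ^ (∑ i, β i) := mul_comm _ _

end Main

end Literature.Combinatorics.StablePolynomials

end
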